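import Summits.RiemannHypothesis.RiemannHypothesis.Theorems.TiltedLandingLaw421R3AntiEscapeSplit7

/-! # TiltedLandingLaw421 — round 3 SUCC^B: the LANDING-EDGE DOOR D5 and the second-order lemma it runs on
(C1 rh-idea-5 g30, v2 = v1 + §3b Taylor currency; answer to director (CA436) «state the second-order lemma the U door needs at the landing edge»;
namespace `RhW08.LandingDoor`; imports ONLY the landed `…R3AntiEscapeSplit7`; closes NOTHING open.)

## The edge, and why no upper-half-plane Rouché door has a uniform constant there (C6 ADD-162/162b/162d/162e, typed in words)

At the lowest state `v` of a stuck level `j`, put `F := f^{(j)}`; the «landing edge» is the regime where `v`'s only door-reachable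
child is a conjugate pair `u, ū` of simple zeros of `F′ = f^{(j+1)}` with `ε := Im u → 0` inside the column and no NL event yet
(the NL event — `u` and `ū` merging into a real double zero of `F′` — is exactly where `ReadyR2` switches on and the level leaves scope).
OBSTRUCTION (paper lemma, maximum principle): take the U door `ClusterNumbersU` with near list `S` and the CANONICAL tilt (the model
`G := M·h = f^{(j)}·(Q′/Q + K)` vanishes at the child, `G(u) = 0`; then `G′(u) = f^{(j)}(u)·(Q′/Q)′(u) = −f^{(j)}(u)·Σ_{s∈S}(u−s)^{-2}`, a slope
PINNED BY THE POLES at `S`).  `(F′ − G)/G` is holomorphic on the closed door disc (`u` is a removable point, `h ≠ 0` there, `M`'s only zero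
is `u`), so `sup_{∂D} ‖F′ − G‖/‖G‖ ≥ |(F′ − G)/G|(u) = |1 − f^{(j+2)}(u)/G′(u)| ≥ 1 − |f^{(j+2)}(u)|/(|f^{(j)}(u)|·|Σ_{s∈S}(u−s)^{-2}|)`, and at
the landing `f^{(j+2)}(u) → f^{(j+2)}(x⋆) = 0` (`x⋆` the real critical point of the trace the pair lands on): the canonical U margin is
`O(ε)`; with the tilt optimised C6 MEASURES `1 − inf sup ≈ 37·(Im u)²` on the vt `n = 4` family (ADD-162d) and six mesh-certified witnesses
down to `Im u = 0.003` (ADD-162e).  Structural reason: `G/f^{(j)} = Q′/Q + K` is MÖBIUS in `L_F := f^{(j+1)}/f^{(j)}` — ONE zero, its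
slope fixed by the poles — while at the landing `L_F` has a NEAR-DOUBLE zero (the pair `u, ū` at distance `2ε`, `L_F′(u) = O(ε)`).
So the U door is TRUE there frame by frame (C6's witnesses) but carries no uniform constant; on that edge family the other four v7 sockets
(N, N_col, C, W) are NO in C6's census (ADD-162), so v7 `DoorAvailLawQ` holds there only through a vanishing margin.

## The second-order lemma = a second-order MODEL: the real quadratic at the near-double real critical point

The cure is a door whose circle contains BOTH `u` and `ū` — a REAL-centred disc `D(x⋆, r)` — with the REAL QUADRATIC model
`q(z) := m + A·(z − x⋆)²`, `m := F′(x⋆)` (real), `m·A > 0` (so `q` has the conjugate pair of zeros `x⋆ ± i√(m/A)` and no real zero).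
Non-realness of the certified zero of `F′` is read off the REAL TRACE: `F′ ≠ 0` on the diameter — i.e. «no NL event in this window yet»,
the scope binder itself — so NO real pigeonhole is needed (twin `LandingNumbersN` in the count currency of D1 uses `RealCritBoundNSig` instead).
* socket ★ `LandingNumbers f x₀ R Hs j` (§2) and door ★ `succ_of_landingNumbers` (PROVED: tree `RhW08.ClusterQM.exists_deriv_zero_of_model_zero`
  with `(G, h, M) := (f^{(j)}, 1, q)` about the real centre, the diameter clause, `succ_of_nonreal_crit_disc_either`);
* ★★ THE SECOND-ORDER LEMMA `landingNumbers_of_defect` (§3, PROVED): numbers `(x⋆, r, m, A, E)` with `m·A > 0`, `2·(m/A) ≤ r²`, a sup-defect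
  `‖f^{(j+1)} − q‖ ≤ E` on `D̄(x⋆, r)` and the ONE margin inequality `E < |m| = |f^{(j+1)}(x⋆)|` give the socket (circle: `‖q‖ ≥ |A|r² − |m| ≥ |m| > E`;
  diameter: `|q(x)| = |m| + |A|(x − x⋆)² ≥ |m| > E`; model zero `x⋆ + i√(m/A)` inside).  By Taylor at a critical point of the real trace
  (`f^{(j+2)}(x⋆) = 0`, `A := f^{(j+3)}(x⋆)/2`, `|f^{(j+4)}| ≤ M₃` on the disc) `E ≤ M₃·r³/6`; with `r := √(2m/A)` the margin inequality reads
  `M₃ < (3/√2)·|A|^{3/2}/|m|^{1/2}` — it IMPROVES as the child lands (`m ≈ A·ε² → 0`): Rouché ratio `O(M₃·ε/|A|)`, complementary to U's `1 − O(ε²)`.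
* §3b ★★ TAYLOR CURRENCY `landingDefect_of_taylor` (PROVED, MVT ×3 on the convex closed disc, constant `M₃r³`): `LandingTaylor` :=
  `x⋆` with `f^{(j+2)}(x⋆) = 0`, `m = f^{(j+1)}(x⋆)`, `2A = f^{(j+3)}(x⋆)`, `m·A > 0`, `2(m/A) ≤ r²`, `‖f^{(j+4)}‖ ≤ M₃` on `D̄(x⋆, r)`, depth, and
  `M₃·r³ < |m|` ⇒ `LandingDefect` ⇒ `LandingNumbers` ⇒ successor (`succ_of_landingTaylor`).  With `r = √(2m/A)`: `M₃ < |A|^{3/2}/(2√2·|m|^{1/2})`.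
* §4 the v8 CANDIDATE law text `DoorAvailLawQ8 := binders → N ∨ N_col ∨ C ∨ U ∨ L ∨ W` (DRAFT — NOT of record until the critic ×2 + census
  cycle and a director key; v7 `RhW08.AntiEscapeSplit7.DoorAvailLawQ` stays the residual of record), `doorAvail8_of_doorAvail7` (v8 is WEAKER),
  and the by-name chain `DoorAvailLawQ8 → AntiEscapeCore → RestSuccBotQ`, `… → Law421P halfPurse`.
Negative edges honoured: no free model (the quadratic is pinned: real centre, `q(x⋆) = f^{(j+1)}(x⋆)`, real coefficient, no real zero), no
level-`(j+1)` STATE inside any socket (only the real trace and one circle of `f^{(j+1)}`, as in the U socket), no `ρ ≤ Hs` cap, no fixed window.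
Nothing here bears on the truth of RH; RH is not proved; `TiltedLandingLaw421R` (33346), `AntiEscapeCore`, `DoorAvailLawQ`, `DoorAvailLawQ8` OPEN. -/

namespace RhW08.LandingDoor

open Complex Set
open scoped ComplexConjugate
open Literature.Analysis.Complex
open Summit.RiemannHypothesis.RiemannHypothesis.Theorems.Splittings.JensenWindow
open RhIdea6.G17.W07C7 RhIdea6.G17.W07C7.Rev6 RhIdea6.G18.W07C8.Law421BirthS RhIdea6.G19.W07C11.Seam
open RhIdea6.G20.W07C12.Frac RhIdea6.G20.W07C12.StColP RhW07.C12.FieldSplit RhIdea6.G21.W07C13.TentMax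
open RhW07.C14.TwoSided RhW07.C14.Classes RhW07.C14.Lineage RhW07.C14.Booking
open RhW07.C13.Heredity RhIdea6.G22.W07C15pre.Injection RhW07.E3.Cell RhW07.E3.Lit
open RhW08.Round1 RhW08.StSwap RhW08.Round2 RhW08.QuadW RhW08.SealSwapQ RhW08.SealSwap RhW08.SuccB RhW08.SuccSplit
open RhW08.SuccTheft RhW08.Column RhW08.Hurwitz RhW08.ClusterQ RhW08.ClusterQM RhW08.NewtonDoor RhW08.NewtonDoorGenusOne RhW08.PurseP
open RhW08.AntiEscapeSplit7

/-! ## §1 The real quadratic landing model -/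

/-- The LANDING MODEL at a real point `x⋆`: `q(z) := m + A·(z − x⋆)²` with real `m, A` (for `m·A > 0` its zeros are the conjugate pair
`x⋆ ± i·√(m/A)` and it has no real zero). -/
noncomputable def landingModel (xs m A : ℝ) : ℂ → ℂ := fun z => (m : ℂ) + (A : ℂ) * (z - (xs : ℂ)) ^ 2

/-- Simp lemma: the landing model evaluated at `z`. -/
@[simp] theorem landingModel_apply (xs m A : ℝ) (z : ℂ) :
    landingModel xs m A z = (m : ℂ) + (A : ℂ) * (z - (xs : ℂ)) ^ 2 := rfl

/-- The landing model is differentiable on `ℂ`. -/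
theorem differentiable_landingModel (xs m A : ℝ) : Differentiable ℂ (landingModel xs m A) := by
  unfold landingModel; fun_prop

/-- On the circle `‖z − x⋆‖ = r`: `‖q(z)‖ ≥ |A|·r² − |m|`. -/
theorem norm_landingModel_circle_ge {xs m A r : ℝ} {z : ℂ} (hz : ‖z - (xs : ℂ)‖ = r) :
    |A| * r ^ 2 - |m| ≤ ‖landingModel xs m A z‖ := by
  have h1 : ‖(A : ℂ) * (z - (xs : ℂ)) ^ 2‖ = |A| * r ^ 2 := by
    rw [norm_mul, norm_pow, hz, Complex.norm_real, Real.norm_eq_abs]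
  have h2 : ‖(A : ℂ) * (z - (xs : ℂ)) ^ 2‖ ≤ ‖landingModel xs m A z‖ + ‖(m : ℂ)‖ := by
    have h := norm_sub_le (landingModel xs m A z) (m : ℂ)
    have heq : landingModel xs m A z - (m : ℂ) = (A : ℂ) * (z - (xs : ℂ)) ^ 2 := by
      simp only [landingModel_apply]; ring
    rwa [heq] at h
  have h3 : ‖(m : ℂ)‖ = |m| := by rw [Complex.norm_real, Real.norm_eq_abs]
  linarith

/-- On the real diameter: for `m·A > 0`, `‖q(x)‖ = |m| + |A|·(x − x⋆)² ≥ |m|`. -/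
theorem norm_landingModel_real_ge {xs m A : ℝ} (hmA : 0 < m * A) (x : ℝ) :
    |m| ≤ ‖landingModel xs m A (x : ℂ)‖ := by
  have hval : landingModel xs m A (x : ℂ) = ((m + A * (x - xs) ^ 2 : ℝ) : ℂ) := by
    simp only [landingModel_apply]; push_cast; ring
  rw [hval, Complex.norm_real, Real.norm_eq_abs]
  have hδ : 0 ≤ (x - xs) ^ 2 := sq_nonneg _
  have hm0 : m ≠ 0 := fun h => by simp [h] at hmA
  rcases lt_or_gt_of_ne hm0 with hm | hm
  · have hA : A < 0 := by nlinarith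
    have hle : m + A * (x - xs) ^ 2 ≤ m := by nlinarith
    rw [abs_of_neg hm, abs_of_nonpos (by linarith)]
    linarith
  · have hA : 0 < A := by nlinarith
    have hle : m ≤ m + A * (x - xs) ^ 2 := by nlinarith
    rw [abs_of_pos hm, abs_of_pos (by linarith)]
    exact hle

/-- For `m·A > 0` the model vanishes at `x⋆ + i·√(m/A)`. -/
theorem landingModel_root {xs m A : ℝ} (hmA : 0 < m * A) :
    landingModel xs m A ((xs : ℂ) + (Real.sqrt (m / A) : ℂ) * I) = 0 := by
  have hd : 0 < m / A := div_pos_iff.mpr (mul_pos_iff.mp hmA)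
  have hA : A ≠ 0 := fun h => by simp [h] at hmA
  have hA' : (A : ℂ) ≠ 0 := by exact_mod_cast hA
  have hsq : ((Real.sqrt (m / A) : ℂ)) ^ 2 = ((m / A : ℝ) : ℂ) := by
    rw [← Complex.ofReal_pow, Real.sq_sqrt hd.le]
  simp only [landingModel_apply, add_sub_cancel_left, mul_pow, Complex.I_sq, hsq]
  push_cast
  field_simp
  ring

/-- … and that root lies in the open disc `D(x⋆, r)` as soon as `m/A < r²`. -/
theorem landingModel_root_mem {xs m A r : ℝ} (hr : 0 < r) (hlt : m / A < r ^ 2) :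
    ‖((xs : ℂ) + (Real.sqrt (m / A) : ℂ) * I) - (xs : ℂ)‖ < r := by
  rw [add_sub_cancel_left, norm_mul, Complex.norm_I, mul_one, Complex.norm_real, Real.norm_eq_abs,
    abs_of_nonneg (Real.sqrt_nonneg _)]
  exact (Real.sqrt_lt' hr).mpr hlt

/-! ## §2 The socket «landing» and its door (pigeonhole-free) -/

/-- ★ SOCKET «landing» (D5; all data = the real trace of `f^{(j+1)}` and ONE real-centred circle).  A real centre `x⋆`, a radius `0 < r`, the
disc column-deep or within the lateral budget (depth clause of D1 verbatim with `(a, ρ) := (x⋆, r)`); the model value PINNED to the trace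
`m = f^{(j+1)}(x⋆)`; a real curvature number `A`; the model `q := landingModel x⋆ m A` has a zero in the OPEN disc; NO ZERO of `f^{(j+1)}` on the
real diameter (no NL event in the window — the in-scope side of `ReadyR2`); and Rouché domination `‖f^{(j+1)} − q‖ < ‖q‖` on the circle. -/
def LandingNumbers (f : ℂ → ℂ) (x₀ R Hs : ℝ) (j : ℕ) : Prop :=
  ∃ xs r m A : ℝ, 0 < r ∧
    (|xs - x₀| + r ≤ R / 2 ∨ (max (|xs - x₀| + r - R / 2) 0) ^ 2 + ((j : ℝ) + 1) * r ^ 2 ≤ ((j : ℝ) + 1) * Hs ^ 2) ∧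
    (m : ℂ) = iteratedDeriv (j + 1) f xs ∧
    (∃ z₀ : ℂ, ‖z₀ - (xs : ℂ)‖ < r ∧ landingModel xs m A z₀ = 0) ∧
    (∀ x : ℝ, |x - xs| < r → iteratedDeriv (j + 1) f x ≠ 0) ∧
    ∀ z : ℂ, ‖z - (xs : ℂ)‖ = r → ‖iteratedDeriv (j + 1) f z - landingModel xs m A z‖ < ‖landingModel xs m A z‖

/-- ★ DOOR D5 from the socket `LandingNumbers` (PROVED over the tree): Rouché `f^{(j+1)}` vs `q·1` about the REAL centre gives a zero `u` of
`f^{(j+1)}` in the open disc (`exists_deriv_zero_of_model_zero`); the diameter clause makes it non-real; `succ_of_nonreal_crit_disc_either`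
(conjugation + depth clause) makes it (or its conjugate) a level-`(j+1)` band state.  No real pigeonhole, no lowest-ness, no `¬ ReadyR2`. -/
theorem succ_of_landingNumbers {η : ℝ} {f : ℂ → ℂ} {x₀ s hmax R Hs : ℝ} {B j : ℕ} {v : ℂ}
    (hE : EngineHyps5 2 η f x₀ s hmax R Hs B) (hv : StTrkDQ η f x₀ s hmax R Hs B j v) (hL : LandingNumbers f x₀ R Hs j) :
    ∃ u : ℂ, StTrkDQ η f x₀ s hmax R Hs B (j + 1) u := by
  obtain ⟨xs, r, m, A, hr, hdepth, -, hMz, hdiam, hdom⟩ := hL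
  have hFd : Differentiable ℂ (iteratedDeriv j f) := differentiable_iteratedDeriv_of_entire hE.1 j
  have hMne : landingModel xs m A ≠ 0 := by
    intro h0
    have h1 := hdom ((xs : ℂ) + (r : ℂ)) (by rw [add_sub_cancel_left, Complex.norm_real, Real.norm_eq_abs, abs_of_pos hr])
    have h2 : landingModel xs m A ((xs : ℂ) + (r : ℂ)) = 0 := congrFun h0 _
    rw [h2, sub_zero, norm_zero] at h1
    exact absurd h1 (not_lt.2 (norm_nonneg _))
  have hdom' : ∀ z : ℂ, ‖z - (xs : ℂ)‖ = r →
      ‖deriv (iteratedDeriv j f) z - landingModel xs m A z * (fun _ : ℂ => (1 : ℂ)) z‖ <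
        ‖landingModel xs m A z * (fun _ : ℂ => (1 : ℂ)) z‖ := by
    intro z hz
    simp only [mul_one]
    rw [← iteratedDeriv_succ]
    exact hdom z hz
  obtain ⟨u, hur, hu0⟩ := exists_deriv_zero_of_model_zero (h := fun _ : ℂ => (1 : ℂ)) hr hFd (differentiable_const _)
    (differentiable_landingModel xs m A) hMne (fun _ _ => one_ne_zero) hdom' hMz
  rw [← iteratedDeriv_succ] at hu0
  have huim : u.im ≠ 0 := by
    intro him
    have hu : u = ((u.re : ℝ) : ℂ) := by
      apply Complex.ext <;> simp [him]
    have hlt : |u.re - xs| < r := by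
      have h1 := Complex.abs_re_le_norm (u - (xs : ℂ))
      simp only [Complex.sub_re, Complex.ofReal_re] at h1
      exact lt_of_le_of_lt h1 hur
    exact hdiam u.re hlt (by rw [← hu]; exact hu0)
  exact succ_of_nonreal_crit_disc_either hE hv hu0 huim hur.le hdepth

/-- SOCKET «landing» in the COUNT CURRENCY of D1 (twin; no diameter clause): the `DominatedModel` triple `(f^{(j)}, 1, q)` with count
`zcountNReal f^{(j)} x⋆ r + 2 ≤ zcountN q x⋆ r` (no real zero of `f^{(j)}` in the tiny disc; `q` has its two zeros inside). -/
def LandingNumbersN (f : ℂ → ℂ) (x₀ R Hs : ℝ) (j : ℕ) : Prop :=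
  ∃ xs r m A : ℝ, 0 < r ∧
    (|xs - x₀| + r ≤ R / 2 ∨ (max (|xs - x₀| + r - R / 2) 0) ^ 2 + ((j : ℝ) + 1) * r ^ 2 ≤ ((j : ℝ) + 1) * Hs ^ 2) ∧
    (m : ℂ) = iteratedDeriv (j + 1) f xs ∧
    zcountNReal (iteratedDeriv j f) xs r + 2 ≤ zcountN (landingModel xs m A) xs r ∧
    ∀ z : ℂ, ‖z - (xs : ℂ)‖ = r → ‖iteratedDeriv (j + 1) f z - landingModel xs m A z‖ < ‖landingModel xs m A z‖

/-- DOOR D5 in count currency = the landed band-deep tilted cluster door D1 `tiltClusterLawQB_of_realBound` fed `(Q, h, M) := (f^{(j)}, 1, q)`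
over the real pigeonhole `RealCritBoundNSig` (closed by name: `RhW08.ClusterQM.realCritBoundNSig_holds`).  The landing door IS D1's mechanism
with a second-order model. -/
theorem succ_of_landingNumbersN (hRB : RealCritBoundNSig) {η : ℝ} {f : ℂ → ℂ} {x₀ s hmax R Hs : ℝ} {B j : ℕ} {v : ℂ}
    (hE : EngineHyps5 2 η f x₀ s hmax R Hs B) (hv : StTrkDQ η f x₀ s hmax R Hs B j v) (hnR : ¬ ReadyR2 η f x₀ s hmax R Hs B j v)
    (hL : LandingNumbersN f x₀ R Hs j) : ∃ u : ℂ, StTrkDQ η f x₀ s hmax R Hs B (j + 1) u := by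
  obtain ⟨xs, r, m, A, hr, hdepth, -, hn, hdom⟩ := hL
  refine tiltClusterLawQB_of_realBound hRB hE hv hnR hr hdepth
    ⟨iteratedDeriv j f, fun _ => (1 : ℂ), landingModel xs m A, differentiable_iteratedDeriv_of_entire hE.1 j,
      differentiable_const _, differentiable_landingModel xs m A, fun z => by simp, fun _ _ => one_ne_zero, rfl, fun z hz => ?_⟩ hn
  simp only [mul_one]
  rw [← iteratedDeriv_succ]
  exact hdom z hz

/-! ## §3 ★★ THE SECOND-ORDER LEMMA: five numbers and one margin inequality give the socket -/

/-- LANDING DEFECT NUMBERS: `(x⋆, r, m, A, E)` with `m = f^{(j+1)}(x⋆)` (pinned), `m·A > 0`, `2·(m/A) ≤ r²`, the sup-defect of the quadratic model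
on the CLOSED disc `‖f^{(j+1)}(z) − q(z)‖ ≤ E` (`‖z − x⋆‖ ≤ r`), the depth clause, and the single margin inequality `E < |m|`.
(Taylor: at a critical point of the real trace, `A := f^{(j+3)}(x⋆)/2`, `E ≤ sup_{D̄}|f^{(j+4)}|·r³/6`; so with `r = √(2m/A)` the socket holds once
`sup|f^{(j+4)}| < (3/√2)·|A|^{3/2}·|m|^{-1/2}` — automatic as the child lands, `m → 0`.) -/
def LandingDefect (f : ℂ → ℂ) (x₀ R Hs : ℝ) (j : ℕ) : Prop :=
  ∃ xs r m A E : ℝ, 0 < r ∧ 0 < m * A ∧ 2 * (m / A) ≤ r ^ 2 ∧ E < |m| ∧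
    (|xs - x₀| + r ≤ R / 2 ∨ (max (|xs - x₀| + r - R / 2) 0) ^ 2 + ((j : ℝ) + 1) * r ^ 2 ≤ ((j : ℝ) + 1) * Hs ^ 2) ∧
    (m : ℂ) = iteratedDeriv (j + 1) f xs ∧
    ∀ z : ℂ, ‖z - (xs : ℂ)‖ ≤ r → ‖iteratedDeriv (j + 1) f z - landingModel xs m A z‖ ≤ E

/-- ★★ THE SECOND-ORDER LEMMA (PROVED): landing defect numbers give the landing socket — circle: `‖f^{(j+1)} − q‖ ≤ E < |m| ≤ |A|r² − |m| ≤ ‖q‖`;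
diameter: `‖q(x)‖ ≥ |m| > E` so `f^{(j+1)}(x) ≠ 0`; model zero `x⋆ + i√(m/A)` inside since `m/A ≤ r²/2 < r²`. -/
theorem landingNumbers_of_defect {f : ℂ → ℂ} {x₀ R Hs : ℝ} {j : ℕ} (h : LandingDefect f x₀ R Hs j) : LandingNumbers f x₀ R Hs j := by
  obtain ⟨xs, r, m, A, E, hr, hmA, hrA, hE, hdepth, hm, hdef⟩ := h
  have hd : 0 < m / A := div_pos_iff.mpr (mul_pos_iff.mp hmA)
  have hA : A ≠ 0 := fun h0 => by simp [h0] at hmA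
  have hApos : 0 < |A| := abs_pos.mpr hA
  have habs : |m| / |A| = m / A := by rw [← abs_div, abs_of_pos hd]
  have hAr : 2 * |m| ≤ |A| * r ^ 2 := by
    have h1 : 2 * (|m| / |A|) ≤ r ^ 2 := by rw [habs]; exact hrA
    have h2 : |A| * (2 * (|m| / |A|)) = 2 * |m| := by field_simp
    nlinarith [mul_le_mul_of_nonneg_left h1 hApos.le]
  refine ⟨xs, r, m, A, hr, hdepth, hm,
    ⟨(xs : ℂ) + (Real.sqrt (m / A) : ℂ) * I, landingModel_root_mem hr (by nlinarith), landingModel_root hmA⟩, ?_, ?_⟩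
  · intro x hx h0
    have h1 : ‖iteratedDeriv (j + 1) f (x : ℂ) - landingModel xs m A (x : ℂ)‖ ≤ E :=
      hdef (x : ℂ) (by rw [← Complex.ofReal_sub, Complex.norm_real, Real.norm_eq_abs]; exact hx.le)
    rw [h0, zero_sub, norm_neg] at h1
    have h2 := norm_landingModel_real_ge (xs := xs) hmA x
    linarith
  · intro z hz
    have h1 := hdef z hz.le
    have h2 := norm_landingModel_circle_ge (m := m) (A := A) hz
    calc ‖iteratedDeriv (j + 1) f z - landingModel xs m A z‖ ≤ E := h1
      _ < |m| := hE
      _ ≤ |A| * r ^ 2 - |m| := by linarith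
      _ ≤ ‖landingModel xs m A z‖ := h2

/-- ★ DOOR D5 from landing defect numbers (the composite the census engine targets). -/
theorem succ_of_landingDefect {η : ℝ} {f : ℂ → ℂ} {x₀ s hmax R Hs : ℝ} {B j : ℕ} {v : ℂ}
    (hE : EngineHyps5 2 η f x₀ s hmax R Hs B) (hv : StTrkDQ η f x₀ s hmax R Hs B j v) (hL : LandingDefect f x₀ R Hs j) :
    ∃ u : ℂ, StTrkDQ η f x₀ s hmax R Hs B (j + 1) u :=
  succ_of_landingNumbers hE hv (landingNumbers_of_defect hL)

/-! ## §3b The TAYLOR CURRENCY (PROVED, MVT ×3): three trace numbers and a fourth-derivative bound give the socket -/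

/-- MVT helper: a function with `φ c = 0` and `‖φ′‖ ≤ C` on the closed disc `D̄(c, r)` satisfies `‖φ z‖ ≤ C·r` there
(`Convex.norm_image_sub_le_of_norm_deriv_le` on the convex closed ball). -/
theorem norm_le_of_deriv_bound {φ φ' : ℂ → ℂ} {c : ℂ} {r C : ℝ} (hφ : ∀ z, HasDerivAt φ (φ' z) z) (h0 : φ c = 0)
    (hb : ∀ z, ‖z - c‖ ≤ r → ‖φ' z‖ ≤ C) {z : ℂ} (hz : ‖z - c‖ ≤ r) : ‖φ z‖ ≤ C * r := by
  have hr0 : 0 ≤ r := le_trans (norm_nonneg _) hz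
  have hC : 0 ≤ C := le_trans (norm_nonneg _) (hb z hz)
  have key : ‖φ z - φ c‖ ≤ C * ‖z - c‖ :=
    Convex.norm_image_sub_le_of_norm_deriv_le (f := φ) (s := Metric.closedBall c r)
      (fun x _ => (hφ x).differentiableAt)
      (fun x hx => by rw [(hφ x).deriv]; exact hb x (mem_closedBall_iff_norm.mp hx))
      (convex_closedBall c r) (mem_closedBall_iff_norm.mpr (by simpa using hr0)) (mem_closedBall_iff_norm.mpr hz)
  rw [h0, sub_zero] at key
  exact key.trans (mul_le_mul_of_nonneg_left hz hC)

/-- THIRD-ORDER TAYLOR DEFECT (MVT ×3, constant `M₃·r³`; the sharp `M₃·r³/6` is not needed): for `g` with three derivatives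
`g₁, g₂, g₃` everywhere and `‖g₃‖ ≤ M₃` on `D̄(c, r)`:  `‖g z − g c − g₁(c)(z − c) − (g₂(c)/2)(z − c)²‖ ≤ M₃·r³` on `D̄(c, r)`. -/
theorem taylor3_defect_of_bound {g g₁ g₂ g₃ : ℂ → ℂ} (h₀ : ∀ z, HasDerivAt g (g₁ z) z) (h₁ : ∀ z, HasDerivAt g₁ (g₂ z) z)
    (h₂ : ∀ z, HasDerivAt g₂ (g₃ z) z) {c : ℂ} {r M₃ : ℝ} (hM : ∀ z, ‖z - c‖ ≤ r → ‖g₃ z‖ ≤ M₃) {z : ℂ} (hz : ‖z - c‖ ≤ r) :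
    ‖g z - g c - g₁ c * (z - c) - g₂ c / 2 * (z - c) ^ 2‖ ≤ M₃ * r ^ 3 := by
  -- step A: ‖g₂ w − g₂ c‖ ≤ M₃·r
  have hA : ∀ w, ‖w - c‖ ≤ r → ‖(fun w => g₂ w - g₂ c) w‖ ≤ M₃ * r := fun w hw =>
    norm_le_of_deriv_bound (φ := fun w => g₂ w - g₂ c) (φ' := g₃) (fun w => (h₂ w).sub_const _) (sub_self _) hM hw
  -- step B: ‖g₁ w − g₁ c − g₂ c·(w − c)‖ ≤ (M₃·r)·r
  have hB : ∀ w, ‖w - c‖ ≤ r → ‖(fun w => g₁ w - g₁ c - g₂ c * (w - c)) w‖ ≤ M₃ * r * r := fun w hw =>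
    norm_le_of_deriv_bound (φ := fun w => g₁ w - g₁ c - g₂ c * (w - c)) (φ' := fun w => g₂ w - g₂ c)
      (fun w => (((h₁ w).sub_const (g₁ c)).sub (((hasDerivAt_id' w).sub_const c).const_mul (g₂ c))).congr_deriv
        (by ring))
      (by simp) hA hw
  -- step C: ‖g w − g c − g₁ c·(w − c) − (g₂ c/2)·(w − c)(w − c)‖ ≤ (M₃·r·r)·r
  have hC : ∀ w, ‖w - c‖ ≤ r →
      ‖(fun w => g w - g c - g₁ c * (w - c) - g₂ c / 2 * ((w - c) * (w - c))) w‖ ≤ M₃ * r * r * r := fun w hw =>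
    norm_le_of_deriv_bound (φ := fun w => g w - g c - g₁ c * (w - c) - g₂ c / 2 * ((w - c) * (w - c)))
      (φ' := fun w => g₁ w - g₁ c - g₂ c * (w - c))
      (fun w => ((((h₀ w).sub_const (g c)).sub (((hasDerivAt_id' w).sub_const c).const_mul (g₁ c))).sub
        ((((hasDerivAt_id' w).sub_const c).mul ((hasDerivAt_id' w).sub_const c)).const_mul (g₂ c / 2))).congr_deriv
        (by ring))
      (by simp) hB hw
  have h := hC z hz
  simp only at h
  calc ‖g z - g c - g₁ c * (z - c) - g₂ c / 2 * (z - c) ^ 2‖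
      = ‖g z - g c - g₁ c * (z - c) - g₂ c / 2 * ((z - c) * (z - c))‖ := by rw [← pow_two]
    _ ≤ M₃ * r * r * r := h
    _ = M₃ * r ^ 3 := by ring

/-- LANDING TAYLOR NUMBERS (the census engine's input): a real point `x⋆` with `f^{(j+2)}(x⋆) = 0` (critical point of the real trace of
`f^{(j+1)}`), `m := f^{(j+1)}(x⋆)`, `A := f^{(j+3)}(x⋆)/2` with `m·A > 0`, a radius with `2·(m/A) ≤ r²`, a bound `‖f^{(j+4)}‖ ≤ M₃` on
`D̄(x⋆, r)`, the depth clause, and the ONE margin inequality `M₃·r³ < |m|`. -/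
def LandingTaylor (f : ℂ → ℂ) (x₀ R Hs : ℝ) (j : ℕ) : Prop :=
  ∃ xs r m A M₃ : ℝ, 0 < r ∧ 0 < m * A ∧ 2 * (m / A) ≤ r ^ 2 ∧ M₃ * r ^ 3 < |m| ∧
    (|xs - x₀| + r ≤ R / 2 ∨ (max (|xs - x₀| + r - R / 2) 0) ^ 2 + ((j : ℝ) + 1) * r ^ 2 ≤ ((j : ℝ) + 1) * Hs ^ 2) ∧
    (m : ℂ) = iteratedDeriv (j + 1) f xs ∧ iteratedDeriv (j + 2) f xs = 0 ∧ ((2 * A : ℝ) : ℂ) = iteratedDeriv (j + 3) f xs ∧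
    ∀ z : ℂ, ‖z - (xs : ℂ)‖ ≤ r → ‖iteratedDeriv (j + 4) f z‖ ≤ M₃

/-- ★★ THE SECOND-ORDER LEMMA IN TAYLOR CURRENCY (PROVED): for an entire `f`, landing Taylor numbers give landing defect numbers with
`E := M₃·r³` (the quadratic model IS the second Taylor polynomial of `f^{(j+1)}` at the critical point `x⋆`). -/
theorem landingDefect_of_taylor {f : ℂ → ℂ} (hf : Differentiable ℂ f) {x₀ R Hs : ℝ} {j : ℕ} (h : LandingTaylor f x₀ R Hs j) :
    LandingDefect f x₀ R Hs j := by
  obtain ⟨xs, r, m, A, M₃, hr, hmA, hrA, hM3, hdepth, hm, h2, hA, hM⟩ := h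
  refine ⟨xs, r, m, A, M₃ * r ^ 3, hr, hmA, hrA, hM3, hdepth, hm, fun z hz => ?_⟩
  have hder : ∀ (k : ℕ) (w : ℂ), HasDerivAt (iteratedDeriv k f) (iteratedDeriv (k + 1) f w) w := fun k w => by
    have hk := ((differentiable_iteratedDeriv_of_entire hf k) w).hasDerivAt
    rwa [← iteratedDeriv_succ] at hk
  have key := taylor3_defect_of_bound (hder (j + 1)) (hder (j + 2)) (hder (j + 3)) hM hz
  have heq : iteratedDeriv (j + 1) f z - landingModel xs m A z =
      iteratedDeriv (j + 1) f z - iteratedDeriv (j + 1) f xs - iteratedDeriv (j + 2) f xs * (z - xs) -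
        iteratedDeriv (j + 3) f xs / 2 * (z - xs) ^ 2 := by
    rw [h2, ← hm, ← hA, landingModel_apply]; push_cast; ring
  rw [heq]; exact key

/-- ★ DOOR D5 from landing Taylor numbers. -/
theorem succ_of_landingTaylor {η : ℝ} {f : ℂ → ℂ} {x₀ s hmax R Hs : ℝ} {B j : ℕ} {v : ℂ}
    (hE : EngineHyps5 2 η f x₀ s hmax R Hs B) (hv : StTrkDQ η f x₀ s hmax R Hs B j v) (hL : LandingTaylor f x₀ R Hs j) :
    ∃ u : ℂ, StTrkDQ η f x₀ s hmax R Hs B (j + 1) u :=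
  succ_of_landingDefect hE hv (landingDefect_of_taylor hE.1 hL)

/-! ## §4 The v8 CANDIDATE law (DRAFT — not of record): v7's five sockets plus «landing» -/

/-- DRAFT v8 DOOR-AVAILABILITY LAW (CANDIDATE ONLY; the residual of record stays `RhW08.AntiEscapeSplit7.DoorAvailLawQ` until a director key):
the binders of `AntiEscapeCore` plus simplicity give Newton numbers at `v`, or at a column pair, or pinned real-centred cluster numbers, or
pinned upper cluster numbers, or LANDING NUMBERS, or a corner-admissible window. -/
def DoorAvailLawQ8 : Prop :=
  ∀ (η : ℝ) (f : ℂ → ℂ) (x₀ s hmax R Hs : ℝ) (B : ℕ), EngineHyps5 2 η f x₀ s hmax R Hs B → ∀ (j : ℕ) (v : ℂ),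
    IsLowest StTrkDQ η f x₀ s hmax R Hs B j v → ¬ ReadyR2 η f x₀ s hmax R Hs B j v →
    ¬ AllInBandInRangeWindow f x₀ R Hs j v → ¬ Dimple f j v → DiscOverlap f j v →
    iteratedDeriv (j + 1) f v ≠ 0 →
    NewtonNumbers f x₀ R Hs j v ∨ NewtonNumbersCol f x₀ R Hs j ∨ ClusterNumbersJ' f x₀ R Hs j ∨ ClusterNumbersU f x₀ R j ∨
      LandingNumbers f x₀ R Hs j ∨ CornerWindow f x₀ R Hs j

/-- v8 is WEAKER than v7 (one more disjunct): whatever proves v7 proves v8. -/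
theorem doorAvail8_of_doorAvail7 (hL : DoorAvailLawQ) : DoorAvailLawQ8 := by
  intro η f x₀ s hmax R Hs B hE j v hlow hnR hwin hdim hov hz
  rcases hL η f x₀ s hmax R Hs B hE j v hlow hnR hwin hdim hov hz with hN | hNc | hC | hU | hW
  · exact Or.inl hN
  · exact Or.inr (Or.inl hNc)
  · exact Or.inr (Or.inr (Or.inl hC))
  · exact Or.inr (Or.inr (Or.inr (Or.inl hU)))
  · exact Or.inr (Or.inr (Or.inr (Or.inr (Or.inr hW))))

/-- ★★ THE v8 SPLIT: the draft law closes `AntiEscapeCore` (six doors). -/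
theorem antiEscapeCore_of_doorAvail8 (hRB : RealCritBoundNSig) (hL : DoorAvailLawQ8) : AntiEscapeCore := by
  intro η f x₀ s hmax R Hs B hE j v hlow hnR hwin hdim hov
  by_cases hz : iteratedDeriv (j + 1) f v = 0
  · exact succ_of_multiple hE hlow.1 hz
  rcases hL η f x₀ s hmax R Hs B hE j v hlow hnR hwin hdim hov hz with hN | hNc | hC | hU | hLd | hW
  · exact succ_of_newtonNumbers hE hlow.1 hN
  · exact succ_of_newtonNumbersCol hE hlow.1 hNc
  · exact succ_of_clusterNumbersJ' hRB hE hlow.1 hnR hC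
  · exact succ_of_clusterNumbersU hE hlow.1 hU
  · exact succ_of_landingNumbers hE hlow.1 hLd
  · exact succ_of_cornerWindow hE hlow.1 hnR hW

/-- `RealCritBoundNSig → DoorAvailLawQ8 → RestSuccBotQ` (the text of `stub_restSuccBotQ` from the draft v8 law). -/
theorem restSuccBotQ_of_doorAvail8 (hRB : RealCritBoundNSig) (hL : DoorAvailLawQ8) : RestSuccBotQ :=
  restSuccBotQ_of_pieces dimpleSig_holds (antiEscape_of_core (antiEscapeCore_of_doorAvail8 hRB hL))

/-- The crux text at `κ = ½` from the draft v8 law and the RATE residual. -/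
theorem law421Half_of_doorAvail8_rate (hRB : RealCritBoundNSig) (hL : DoorAvailLawQ8) (hR : RestRateBotPQ halfPurse) :
    Law421P halfPurse :=
  law421Half_of_succ_rate (restSuccBotQ_of_doorAvail8 hRB hL) hR

end RhW08.LandingDoor
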